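import Summits.MatrixMultiplication.MatrixMultiplication.Theses.LevelGradedCohnUmans
import Summits.MatrixMultiplication.MatrixMultiplication.Theorems.LevelTwoBeatsCubes.Negative.GradedNeumannCount
import Literature.RepresentationTheory.FiniteGroups.IrreducibleCharacters
import Literature.RepresentationTheory.FiniteGroups.BrauerTheorem
import Literature.Computability.AlgebraicComplexity.CohnUmansTPPProofs

/-!
# Disproof of `GradedPricing` — findings (cdisprove seat, crux `stmt-MatrixMultiplication-7611`)

Crux (route `LevelGradedCohnUmans`, rank 2), informally:

  for every finite group `G`, every BI-INVARIANT subspace `J ≤ ℂ^G` and every `J`-SEPARATED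
  triple `X, Y, Z ⊆ G`:   `(|X||Y||Z|)^(ω/3) ≤ Σᶠ_{χ ∈ Irr(G) ∩ J} χ(1)^ω`   (`ω = omega ℂ`).

## Verdict after cycle 2 (2026-08-16): NO KILL POSSIBLE — the crux is KERNEL-PROVED

Cycle 2 re-checked the ideator-1 candidate `Cruxes/GradedPricing/SketchIdeator1.lean`
(`MatrixUnitSandwich.gradedPricing_candidate : …Theses.LevelGradedCohnUmans.GradedPricing`) on the
farm: rc 0, 0 sorries, `#print axioms` = `[propext, Classical.choice, Quot.sound]`, audit class
`proof-of-item`, `closed: true`.  So `GradedPricing` is a theorem of the tree's definitions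
(`omega`, `irrChars`) and no counterexample exists; the only residual adversarial question — is it
true FOR THE WRONG REASON (junk `omega` / too-large `irrChars`)? — is answered NO by §0 (the
`J = ⊤` instance is the proved CKSU 2005 Thm 1.8 with the same `charDegreePowSum`, `ω ∈ [2,3]`,
`IsIrrChar` demands an irreducible finite-dimensional representation).  What the standing
adversary adds in cycle 2 is therefore BARRIER knowledge for what the crux feeds (the route target
`GradedDesignFamily`, which needs `J`-separated triples with `Σ_{χ∈J} χ(1)^{2+ε} < V^{(2+ε)/3}`):

* §4 ABELIAN HOSTS ARE DEAD EVEN GRADED (new, kernel-checked; landing copy `Negative/AbelianHosts.lean`):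
  `volume_le_finrank_of_comm` — `G` abelian, `J` right-invariant, `J`-separated ⇒ `|X||Y||Z| ≤ dim J`
  (the translates `t ↦ f_{x₀z₀}(t y₀⁻¹)` restrict to the point indicators of `X⁻¹YZ`);
  Fourier support `dim J ≤ #(Irr ∩ J)` (`le_span_irrChars_inter_of_comm`); hence
  `rpow_volume_le_gradedBudget_of_comm`: `V^{s/3} ≤ Σᶠ_{χ∈Irr∩J} χ(1)^s` for EVERY `0 < s ≤ 3` — in an
  abelian group the crux holds with `ω` replaced by `3`, so there is no room below exponent `3`, and
  `not_abelianGradedDesignFamily`: the abelian version of the route target is FALSE (graded analogue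
  of "abelian groups cannot beat `n³`": injectivity of `(x,y,z) ↦ xyz`, refined from `|G|` to `dim J`).
* §5 WALLS / EXPONENT-2 ENDPOINT (general `G`, from the landed graded Neumann count of the sibling
  crux 7612): `volume_sq_le_finrank_cube` — bi-invariant `J`, `J`-separated ⇒ `V² ≤ (dim J)³`, i.e.
  `V^{2/3} ≤ dim J = Σ_{χ∈J} χ(1)²` (`rpow_two_thirds_volume_le_finrank`): the crux's inequality at
  exponent `2` is a triviality of the walls, at exponent `ω` it is the proved crux, at exponent `3`
  it is FALSE in print (§2, CKSU05 §2) — so the exponent `ω` is the sharp content, and a single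
  isotypic block (`dim J = d²`) carries volume `≤ d³` (never beats its own cube).

## Verdict after cycle 1 (2026-08-16): NO KILL — the statement is a theorem, faithfully rendered

It is the finite-group `R_sep` form of Blasiak–Cohn–Grochow–Pratt–Umans 2024, Thm 2.2, and the
Lean rendering has no junk escape (§0).  Everything below is kernel-checked (no `sorry`).

* §0 READING — `gradedPricing_iff` restates the crux through `BiInvariant`, `Separated`, `volPow`,
  `budget` (`Iff.rfl`).  Junk audit: `ω/3 > 0`, so `0 ^ (ω/3) = 0` and empty triples are harmless;
  the `finsum` is a genuine finite sum (`irrChars_finite_holds`); `(χ 1).re = dim ≥ 1`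
  (`apply_one_ne_zero`).  ANCHOR: at full budget `J = ⊤` the crux IS the tree's proved
  CKSU 2005 Thm 1.8 (`gradedPricing_top`, from `CKSU2005_thm18_holds` + separation ⇒ TPP), so the
  volume / budget / exponent bookkeeping of the rendering is already exercised by a proof.
* §1 LOAD-BEARING HYPOTHESES — each dropped in turn, each time a 2-element-group counterexample:
  `gradedPricing_false_without_biInv` (J = ℂ·δ_g is not bi-invariant: volume 1, budget 0),
  `gradedPricing_false_without_ones` (drop "f = 1 on the pattern": J = ⊥, f = 0),
  `gradedPricing_false_without_zeros` (drop "f = 0 off the pattern": J = constants, f = 1, X = G).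
  So any proof must use bi-invariance and BOTH halves of the separation pattern.
* §2b ONE-SIDED INVARIANCE — `gradedPricing_false_with_leftInv_only`: in `S₃` the LEFT-invariant
  column space `J_col` of the 2-dim irrep separates `({1},{1},{1})` with budget `0`
  (`irrChars_inter_Jcol = ∅` by a class-function computation), so "left-invariant `J`" is NOT
  enough — the two-sidedness of `J^⊥` is exactly what makes `χ ∈ J` count the blocks read.
  §2c (cycle 2) `gradedPricing_false_with_rightInv_only`: the mirror (ROW space `J_row`,
  right-invariant, budget `0`) — neither one-sided ideal structure suffices.
* §2 TIGHTNESS / STRENGTHENINGS — `gradedPricing_tight`: `G = Z/2`, `J` = constants,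
  `X = Y = Z = {1}` satisfies all hypotheses with BOTH sides `= 1`; hence
  `not_gradedPricingStrict` (strict `<` is false; the implicit constant 1 is optimal).
  Exponent `3` in place of `ω` (`GradedCubePacking`, "a graded design never beats the graded sum of
  cubes") is FALSE IN PRINT already at `J = ⊤` (CKSU 2005 §2: a TPP triple beating `Σ dᵢ³` in a
  group of order `2n⁶`, `n ≥ 5`), far beyond `decide`: recorded as the CONDITIONAL refutation
  `not_gradedCubePacking_of_beatsCubes` (any cube-beating TPP triple kills it; at `J = ⊤`
  separation ⟺ TPP, `separated_top_of_tpp` / `realizesTPP_of_separated`).  A single isotypic block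
  can never beat cubes (walls `|X||Y|, |Y||Z|, |Z||X| ≤ dim J = d²` give volume `≤ d³`), so graded
  cube-beaters need ≥ 2 blocks.
* §3 WHY IT RESISTS (for the provers) — see the docstring of `whyItResists` at the end: proof
  sketch, the tree lemmas to reuse, and one bookkeeping subtlety (read test functions as
  FUNCTIONALS: `f ∈ M_ρ` factors through block `ρ`, `J^⊥ = ⊕_{ρ∉S}` blocks; embedding
  `f ↦ Σ f(g)·g` instead would land `M_ρ` in the block of `ρ*` — harmless, `d_ρ = d_ρ*`).
* `-- Targets`: none (payload.stuck_stubs = [] at cycles 1 and 2; the crux itself is proved).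

Next regimes (cycle 1's list, now settled): the abelian graded-design sanity check ("can `7`
characters of `Z/N` separate a `⟨2,2,2⟩` TPP triple?") is answered in general by §4 — NO abelian
graded design of ANY shape has `|X||Y||Z| > #(Irr ∩ J)`.  Directions left open concern the TARGET,
not the crux.  Framing for planners (from §5 + Peter–Weyl `Σ_{χ∈J} χ(1)² = dim J =: D`): the
target's budget satisfies `Σ_{χ∈J} χ(1)^{2+ε} ≥ D`, so a witness at `ε` needs
`V > D^{3/(2+ε)} = D^{3/2} · D^{-3ε/(4+2ε)}`, while the walls cap `V ≤ D^{3/2}`: the target is a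
NEAR-EXTREMAL packing problem against the walls in every host (volume within the factor
`D^{3ε/(4+2ε)}` of the ceiling), abelian hosts being excluded outright (§4, `V ≤ D`).  A graded
quasirandom barrier (BCGPU 2023 Thm 3.2 with `|G|` replaced by `D` and `n(G)` by the least visible
degree) would close that window for hosts with large visible degrees; it is not attempted here.
-/

noncomputable section

set_option linter.dupNamespace false

open scoped BigOperators
open Literature.RepresentationTheory.FiniteGroups Literature.Computability.AlgebraicComplexity
open Summit.MatrixMultiplication.MatrixMultiplication.Theses.LevelGradedCohnUmans

namespace Summit.MatrixMultiplication.MatrixMultiplication.Cruxes.GradedPricing.Disproof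

/-! ## §0 Reading of the statement -/

section Reading

variable {G : Type} [Group G]

/-- Bi-invariance of the test space, verbatim from the crux. -/
def BiInvariant (J : Submodule ℂ (G → ℂ)) : Prop :=
  ∀ f ∈ J, ∀ a b : G, (fun g : G => f (a * g * b)) ∈ J

/-- `J`-separation of `(X, Y, Z)`, verbatim from the crux (BCGPU24 Def 2.1 + TPP at the target). -/
def Separated (J : Submodule ℂ (G → ℂ)) (X Y Z : Finset G) : Prop :=
  ∀ x₀ ∈ X, ∀ z₀ ∈ Z, ∃ f ∈ J, ∀ x ∈ X, ∀ y ∈ Y, ∀ y' ∈ Y, ∀ z ∈ Z,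
    (x = x₀ ∧ y = y' ∧ z = z₀ → f (x⁻¹ * y * y'⁻¹ * z) = 1) ∧
    (¬ (x = x₀ ∧ y = y' ∧ z = z₀) → f (x⁻¹ * y * y'⁻¹ * z) = 0)

/-- Separation with ONLY the "value 1 on the pattern" half (mutation used in §1). -/
def SeparatedOnes (J : Submodule ℂ (G → ℂ)) (X Y Z : Finset G) : Prop :=
  ∀ x₀ ∈ X, ∀ z₀ ∈ Z, ∃ f ∈ J, ∀ x ∈ X, ∀ y ∈ Y, ∀ y' ∈ Y, ∀ z ∈ Z,
    (x = x₀ ∧ y = y' ∧ z = z₀ → f (x⁻¹ * y * y'⁻¹ * z) = 1)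

/-- Separation with ONLY the "value 0 off the pattern" half (mutation used in §1). -/
def SeparatedZeros (J : Submodule ℂ (G → ℂ)) (X Y Z : Finset G) : Prop :=
  ∀ x₀ ∈ X, ∀ z₀ ∈ Z, ∃ f ∈ J, ∀ x ∈ X, ∀ y ∈ Y, ∀ y' ∈ Y, ∀ z ∈ Z,
    (¬ (x = x₀ ∧ y = y' ∧ z = z₀) → f (x⁻¹ * y * y'⁻¹ * z) = 0)

/-- Left-hand side of the crux: `(|X||Y||Z|)^(ω/3)`. -/
def volPow (X Y Z : Finset G) : ℝ :=
  ((X.card * Y.card * Z.card : ℕ) : ℝ) ^ (omega ℂ / 3)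

/-- Right-hand side of the crux: the GRADED budget `Σᶠ_{χ ∈ Irr(G) ∩ J} χ(1)^ω`. -/
def budget (G : Type) [Group G] (J : Submodule ℂ (G → ℂ)) : ℝ :=
  ∑ᶠ χ ∈ irrChars G ∩ (J : Set (G → ℂ)), (χ 1).re ^ omega ℂ

/-- The crux, read back through the abbreviations (definitional). -/
theorem gradedPricing_iff :
    GradedPricing ↔ ∀ (G : Type) [Group G] [Fintype G] (J : Submodule ℂ (G → ℂ)),
      BiInvariant J → ∀ X Y Z : Finset G, Separated J X Y Z → volPow X Y Z ≤ budget G J :=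
  Iff.rfl

/-- Junk audit 1: the exponent `ω/3` is positive (`ω ≥ 2`, FlatteningBound), so `0 ^ (ω/3) = 0`
and a triple with an empty set has `volPow = 0 ≤ budget` — no vacuity escape there. -/
theorem omega_div_three_pos : 0 < omega ℂ / 3 :=
  div_pos (zero_lt_two.trans_le (omega_two_le (K := ℂ))) three_pos

omit [Group G] in
theorem volPow_of_card_mul_eq_zero {X Y Z : Finset G} (h : X.card * Y.card * Z.card = 0) :
    volPow X Y Z = 0 := by
  rw [volPow, h, Nat.cast_zero, Real.zero_rpow omega_div_three_pos.ne']

/-- Junk audit 2: an irreducible character does not vanish at `1` (an irreducible representation is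
non-zero), so every term of the budget is `d^ω ≥ 1` and `Irr(G) ∩ J` is exactly the finsum's support. -/
theorem apply_one_ne_zero {χ : G → ℂ} (h : IsIrrChar G χ) : χ 1 ≠ 0 := by
  obtain ⟨V, _, _, _, ρ, hρ, rfl⟩ := h
  haveI := hρ
  haveI : Nontrivial V := by
    by_contra hV
    rw [not_nontrivial_iff_subsingleton] at hV
    have hbt : (⊥ : Subrepresentation ρ) = ⊤ :=
      Subrepresentation.toSubmodule_injective (Subsingleton.elim _ _)
    exact (IsSimpleOrder.bot_ne_top (α := Subrepresentation ρ)) hbt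
  rw [Representation.char_one]
  exact Nat.cast_ne_zero.mpr Module.finrank_pos.ne'

/-- The budget is non-negative (each term is `d^ω` with `d = (χ 1).re ≥ 0`). -/
theorem budget_nonneg (J : Submodule ℂ (G → ℂ)) : 0 ≤ budget G J := by
  refine finsum_nonneg fun χ => finsum_nonneg fun hχ => ?_
  obtain ⟨d, -, hd⟩ := IsIrrChar.exists_apply_one (G := G) hχ.1
  rw [hd]
  exact Real.rpow_nonneg (by simp) _

/-- Junk audit 3: the budget is a genuine finite sum — `Irr(G)` is finite for finite `G`
(`irrChars_finite_holds`), so the `finsum` never silently returns `0`. -/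
theorem irrChars_inter_finite [Finite G] (J : Submodule ℂ (G → ℂ)) :
    (irrChars G ∩ (J : Set (G → ℂ))).Finite :=
  (irrChars_finite_holds G).subset Set.inter_subset_left

/-- A constant irreducible character is the trivial character `1` (orthonormality:
`⟨χ, χ⟩ = χ(1)² = 1` forces the degree to be `1`). -/
theorem irrChar_eq_one_of_forall_eq [Fintype G] {χ : G → ℂ} (h : IsIrrChar G χ)
    (hc : ∀ g, χ g = χ 1) : χ = 1 := by
  have h1 := h.classInner_eq h
  rw [if_pos rfl, classInner_apply] at h1
  have hsum : ∑ s : G, χ s * χ s⁻¹ = Fintype.card G * (χ 1 * χ 1) := by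
    rw [Finset.sum_congr rfl (fun s _ => by rw [hc s, hc s⁻¹]), Finset.sum_const, Finset.card_univ,
      nsmul_eq_mul]
  rw [hsum, ← mul_assoc, inv_mul_cancel₀ (Nat.cast_ne_zero.mpr Fintype.card_ne_zero), one_mul] at h1
  obtain ⟨d, -, hd⟩ := h.exists_apply_one
  rw [hd] at h1
  have hdd : d * d = 1 := by exact_mod_cast h1
  have hd1 : d = 1 := by
    rcases Nat.lt_or_ge d 2 with hlt | hge
    · interval_cases d <;> simp_all
    · nlinarith
  funext g
  rw [hc g, hd, hd1, Nat.cast_one, Pi.one_apply]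

/-- The trivial character is the constant function `1`. -/
theorem character_trivial_eq_one : (Representation.trivial ℂ G ℂ).character = 1 := by
  funext g
  have h1 : Representation.trivial ℂ G ℂ g = LinearMap.id :=
    LinearMap.ext fun v => Representation.trivial_apply ℂ g v
  rw [Representation.character, h1, LinearMap.trace_id, Module.finrank_self]
  simp

theorem one_mem_irrChars : (1 : G → ℂ) ∈ irrChars G :=
  character_trivial_eq_one (G := G) ▸ character_trivial_mem_irrChars

/-- `Irr(G) ∩ (constants) = {1}`. -/
theorem irrChars_inter_span_one [Fintype G] :
    irrChars G ∩ ((Submodule.span ℂ {(1 : G → ℂ)} : Submodule ℂ (G → ℂ)) : Set (G → ℂ)) = {1} := by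
  ext χ
  simp only [Set.mem_inter_iff, SetLike.mem_coe, Submodule.mem_span_singleton,
    Set.mem_singleton_iff]
  constructor
  · rintro ⟨hχ, c, rfl⟩
    exact irrChar_eq_one_of_forall_eq hχ (fun g => by simp)
  · rintro rfl
    exact ⟨one_mem_irrChars, 1, one_smul _ _⟩

/-- The budget of the constants is exactly `1`. -/
theorem budget_span_one [Fintype G] :
    budget G (Submodule.span ℂ {(1 : G → ℂ)}) = 1 := by
  rw [budget, irrChars_inter_span_one, finsum_mem_singleton]
  simp

/-- `Irr(G) ∩ ℂ·δ_g = ∅` for `g ≠ 1` (every `f ∈ ℂ·δ_g` vanishes at `1`). -/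
theorem irrChars_inter_span_single [DecidableEq G] {g : G} (hg : g ≠ 1) :
    irrChars G ∩ ((Submodule.span ℂ {(Pi.single g (1 : ℂ) : G → ℂ)} : Submodule ℂ (G → ℂ)) :
      Set (G → ℂ)) = ∅ := by
  ext χ
  simp only [Set.mem_inter_iff, SetLike.mem_coe, Submodule.mem_span_singleton,
    Set.mem_empty_iff_false, iff_false, not_and]
  rintro hχ ⟨c, rfl⟩
  exact apply_one_ne_zero hχ (by simp [hg.symm])

/-- The budget of `ℂ·δ_g` (`g ≠ 1`) is `0`. -/
theorem budget_span_single [DecidableEq G] {g : G} (hg : g ≠ 1) :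
    budget G (Submodule.span ℂ {(Pi.single g (1 : ℂ) : G → ℂ)}) = 0 := by
  rw [budget, irrChars_inter_span_single hg, finsum_mem_empty]

/-- `Irr(G) ∩ ⊥ = ∅` and the budget of `⊥` is `0`. -/
theorem budget_bot : budget G (⊥ : Submodule ℂ (G → ℂ)) = 0 := by
  have h : irrChars G ∩ ((⊥ : Submodule ℂ (G → ℂ)) : Set (G → ℂ)) = ∅ := by
    ext χ
    simp only [Set.mem_inter_iff, Submodule.bot_coe, Set.mem_singleton_iff,
      Set.mem_empty_iff_false, iff_false, not_and]
    rintro hχ rfl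
    exact apply_one_ne_zero hχ rfl
  rw [budget, h, finsum_mem_empty]

/-- The constants form a bi-invariant test space. -/
theorem biInvariant_span_one : BiInvariant (Submodule.span ℂ {(1 : G → ℂ)}) := by
  intro f hf a b
  obtain ⟨c, rfl⟩ := Submodule.mem_span_singleton.mp hf
  exact Submodule.mem_span_singleton.mpr ⟨c, by funext g; simp⟩

theorem biInvariant_bot : BiInvariant (⊥ : Submodule ℂ (G → ℂ)) := by
  intro f hf a b
  rw [Submodule.mem_bot] at hf ⊢
  subst hf
  rfl

/-- Full budget: `budget G ⊤ = Σ_{χ ∈ Irr G} χ(1)^ω = charDegreePowSum G ω`. -/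
theorem budget_top : budget G ⊤ = charDegreePowSum G (omega ℂ) := by
  rw [budget, charDegreePowSum, Submodule.top_coe, Set.inter_univ]

/-- Separation implies the triple product property in the tree's `RealizesTPP` form (target
`(s, u')`, quadruple `(s', t, t', u)`): the content of the route's support item `SepImpliesTPP`,
reproved here only to anchor §0. -/
theorem realizesTPP_of_separated (J : Submodule ℂ (G → ℂ)) {X Y Z : Finset G}
    (h : Separated J X Y Z) : RealizesTPP G X.card Y.card Z.card := by
  refine ⟨X, Y, Z, rfl, rfl, rfl, ?_⟩
  intro s hs s' hs' t ht t' ht' u hu u' hu' hprod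
  obtain ⟨f, -, hf⟩ := h s hs u' hu'
  -- the pattern quadruple `(s, t, t, u')` gives `f (s⁻¹ u') = 1`
  have hone : f (s⁻¹ * t * t⁻¹ * u') = 1 := (hf s hs t ht t ht u' hu').1 ⟨rfl, rfl, rfl⟩
  -- the quadruple `(s', t, t', u)` hits the same group element
  have heq : s'⁻¹ * t * t'⁻¹ * u = s⁻¹ * t * t⁻¹ * u' := by
    have : s * s'⁻¹ * (t * t'⁻¹) * (u * u'⁻¹) * u' = u' := by rw [hprod, one_mul]
    calc s'⁻¹ * t * t'⁻¹ * u = s⁻¹ * (s * s'⁻¹ * (t * t'⁻¹) * (u * u'⁻¹) * u') := by group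
      _ = s⁻¹ * u' := by rw [this]
      _ = s⁻¹ * t * t⁻¹ * u' := by group
  have h2 := hf s' hs' t ht t' ht' u hu
  by_contra hne
  have hzero : f (s'⁻¹ * t * t'⁻¹ * u) = 0 := h2.2 (fun ⟨h1, h2, h3⟩ => hne ⟨h1.symm, h2, h3⟩)
  rw [heq, hone] at hzero
  exact one_ne_zero hzero

/-- ANCHOR (§0): at FULL budget `J = ⊤` the crux is exactly the tree's proved CKSU 2005 Thm 1.8
(`CKSU2005_thm18_holds`).  So the rendering of volume, budget and exponent is already exercised by
a kernel-checked proof; what the provers owe is only the graded refinement `J ⊊ ⊤`. -/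
theorem gradedPricing_top [Fintype G] (X Y Z : Finset G) (h : Separated (⊤ : Submodule ℂ (G → ℂ)) X Y Z) :
    volPow X Y Z ≤ budget G ⊤ := by
  rw [budget_top, volPow]
  exact CKSU2005_thm18_holds G _ _ _ (realizesTPP_of_separated ⊤ h)

end Reading

/-! ## §1 Load-bearing hypotheses: drop each one, refute the remainder -/

section LoadBearing

/-- The 2-element witness group used throughout. -/
abbrev G₂ : Type := Multiplicative (ZMod 2)

/-- Its non-identity element. -/
def g₂ : G₂ := Multiplicative.ofAdd 1

theorem g₂_ne_one : g₂ ≠ 1 := by decide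

theorem card_G₂ : Fintype.card G₂ = 2 := by simp

/-- Mutation A: bi-invariance of `J` dropped. -/
def GradedPricingWithoutBiInv : Prop :=
  ∀ (G : Type) [Group G] [Fintype G] (J : Submodule ℂ (G → ℂ)),
    ∀ X Y Z : Finset G, Separated J X Y Z → volPow X Y Z ≤ budget G J

/-- **Bi-invariance is load-bearing.**  Witness: `G = Z/2`, `J = ℂ·δ_g` (`g ≠ 1`; NOT bi-invariant),
`X = Y = {1}`, `Z = {g}`: every quadruple is the pattern, `δ_g` separates, `volPow = 1`, but no
irreducible character lies in `ℂ·δ_g` (all vanish at `1`), so `budget = 0`. -/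
theorem gradedPricing_false_without_biInv : ¬ GradedPricingWithoutBiInv := by
  intro h
  set J : Submodule ℂ (G₂ → ℂ) := Submodule.span ℂ {(Pi.single g₂ (1 : ℂ) : G₂ → ℂ)} with hJ
  have hsep : Separated J {1} {1} {g₂} := by
    intro x₀ hx₀ z₀ hz₀
    refine ⟨Pi.single g₂ 1, Submodule.subset_span rfl, ?_⟩
    intro x hx y hy y' hy' z hz
    simp only [Finset.mem_singleton] at hx hy hy' hz hx₀ hz₀
    subst hx hy hy' hz hx₀ hz₀
    exact ⟨fun _ => by simp, fun hne => absurd ⟨rfl, rfl, rfl⟩ hne⟩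
  have hle := h G₂ J {1} {1} {g₂} hsep
  rw [hJ, budget_span_single g₂_ne_one] at hle
  have h1 : volPow ({1} : Finset G₂) {1} {g₂} = 1 := by simp [volPow]
  linarith

/-- Mutation B: the "value 1 on the pattern" half of separation dropped. -/
def GradedPricingWithoutOnes : Prop :=
  ∀ (G : Type) [Group G] [Fintype G] (J : Submodule ℂ (G → ℂ)), BiInvariant J →
    ∀ X Y Z : Finset G, SeparatedZeros J X Y Z → volPow X Y Z ≤ budget G J

/-- **"f = 1 on the pattern" is load-bearing.**  Witness: `J = ⊥`, `f = 0` vanishes off (and on)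
the pattern; `X = Y = Z = {1}` has `volPow = 1 > 0 = budget ⊥`. -/
theorem gradedPricing_false_without_ones : ¬ GradedPricingWithoutOnes := by
  intro h
  have hsep : SeparatedZeros (⊥ : Submodule ℂ (G₂ → ℂ)) {1} {1} {1} := by
    intro x₀ _ z₀ _
    exact ⟨0, Submodule.zero_mem _, fun x _ y _ y' _ z _ _ => rfl⟩
  have hle := h G₂ ⊥ biInvariant_bot {1} {1} {1} hsep
  rw [budget_bot] at hle
  have h1 : volPow ({1} : Finset G₂) {1} {1} = 1 := by simp [volPow]
  linarith

/-- Mutation C: the "value 0 off the pattern" half of separation dropped. -/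
def GradedPricingWithoutZeros : Prop :=
  ∀ (G : Type) [Group G] [Fintype G] (J : Submodule ℂ (G → ℂ)), BiInvariant J →
    ∀ X Y Z : Finset G, SeparatedOnes J X Y Z → volPow X Y Z ≤ budget G J

/-- **"f = 0 off the pattern" is load-bearing** (it is where the TPP lives).  Witness: `G = Z/2`,
`J` = constants (bi-invariant, budget `1`), `f = 1`; `X = G`, `Y = Z = {1}`:
`volPow = 2^(ω/3) > 1 = budget`. -/
theorem gradedPricing_false_without_zeros : ¬ GradedPricingWithoutZeros := by
  intro h
  have hsep : SeparatedOnes (Submodule.span ℂ {(1 : G₂ → ℂ)}) Finset.univ {1} {1} := by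
    intro x₀ _ z₀ _
    exact ⟨1, Submodule.subset_span rfl, fun x _ y _ y' _ z _ _ => rfl⟩
  have hle := h G₂ _ biInvariant_span_one Finset.univ {1} {1} hsep
  rw [budget_span_one] at hle
  have h1 : volPow (Finset.univ : Finset G₂) {1} {1} = (2 : ℝ) ^ (omega ℂ / 3) := by
    simp [volPow]
  have h2 : (1 : ℝ) < (2 : ℝ) ^ (omega ℂ / 3) := Real.one_lt_rpow one_lt_two omega_div_three_pos
  linarith

end LoadBearing

/-! ## §2 Tightness and natural strengthenings -/

section Tightness

/-- **The inequality is attained.**  `G = Z/2`, `J` = constants, `X = Y = Z = {1}`: bi-invariant,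
separated (by `f = 1`; every quadruple is the pattern), and `volPow = 1 = budget`. -/
theorem gradedPricing_tight :
    BiInvariant (Submodule.span ℂ {(1 : G₂ → ℂ)}) ∧
    Separated (Submodule.span ℂ {(1 : G₂ → ℂ)}) {1} {1} {1} ∧
    volPow ({1} : Finset G₂) {1} {1} = budget G₂ (Submodule.span ℂ {(1 : G₂ → ℂ)}) := by
  refine ⟨biInvariant_span_one, ?_, ?_⟩
  · intro x₀ hx₀ z₀ hz₀
    refine ⟨1, Submodule.subset_span rfl, ?_⟩
    intro x hx y hy y' hy' z hz
    simp only [Finset.mem_singleton] at hx hy hy' hz hx₀ hz₀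
    subst hx hy hy' hz hx₀ hz₀
    exact ⟨fun _ => rfl, fun hne => absurd ⟨rfl, rfl, rfl⟩ hne⟩
  · rw [budget_span_one]
    simp [volPow]

/-- Strengthening 1: strict inequality. -/
def GradedPricingStrict : Prop :=
  ∀ (G : Type) [Group G] [Fintype G] (J : Submodule ℂ (G → ℂ)), BiInvariant J →
    ∀ X Y Z : Finset G, Separated J X Y Z → volPow X Y Z < budget G J

/-- **The strict form is false** (by `gradedPricing_tight`). -/
theorem not_gradedPricingStrict : ¬ GradedPricingStrict := by
  intro h
  obtain ⟨hbi, hsep, heq⟩ := gradedPricing_tight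
  exact (h G₂ _ hbi {1} {1} {1} hsep).ne heq

/-- Strengthening 2: exponent `3` in place of `ω` — "a graded design never beats the GRADED sum of
the cubes". -/
def GradedCubePacking : Prop :=
  ∀ (G : Type) [Group G] [Fintype G] (J : Submodule ℂ (G → ℂ)), BiInvariant J →
    ∀ X Y Z : Finset G, Separated J X Y Z →
      ((X.card * Y.card * Z.card : ℕ) : ℝ) ≤ ∑ᶠ χ ∈ irrChars G ∩ (J : Set (G → ℂ)), (χ 1).re ^ (3 : ℝ)

/-- `⊤` is bi-invariant. -/
theorem biInvariant_top {G : Type} [Group G] : BiInvariant (⊤ : Submodule ℂ (G → ℂ)) :=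
  fun _ _ _ _ => Submodule.mem_top

/-- At full budget the converse of `realizesTPP_of_separated` holds: a TPP triple (in the tree's
`RealizesTPP` clause form) is `⊤`-separated, by the point indicators `δ_{x₀⁻¹ z₀}`.  Hence at
`J = ⊤` the crux is EQUIVALENT to CKSU 2005 Thm 1.8. -/
theorem separated_top_of_tpp {G : Type} [Group G] [DecidableEq G] {X Y Z : Finset G}
    (h : ∀ s ∈ X, ∀ s' ∈ X, ∀ t ∈ Y, ∀ t' ∈ Y, ∀ u ∈ Z, ∀ u' ∈ Z,
      s * s'⁻¹ * (t * t'⁻¹) * (u * u'⁻¹) = 1 → s = s' ∧ t = t' ∧ u = u') :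
    Separated (⊤ : Submodule ℂ (G → ℂ)) X Y Z := by
  intro x₀ hx₀ z₀ hz₀
  refine ⟨Pi.single (x₀⁻¹ * z₀) 1, Submodule.mem_top, ?_⟩
  intro x hx y hy y' hy' z hz
  constructor
  · rintro ⟨rfl, rfl, rfl⟩
    rw [mul_inv_cancel_right, Pi.single_eq_same]
  · intro hne
    rw [Pi.single_apply, if_neg]
    intro heq
    apply hne
    have key : x₀ * x⁻¹ * (y * y'⁻¹) * (z * z₀⁻¹) = 1 := by
      calc x₀ * x⁻¹ * (y * y'⁻¹) * (z * z₀⁻¹) = x₀ * (x⁻¹ * y * y'⁻¹ * z) * z₀⁻¹ := by group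
        _ = x₀ * (x₀⁻¹ * z₀) * z₀⁻¹ := by rw [heq]
        _ = 1 := by group
    obtain ⟨h1, h2, h3⟩ := h x₀ hx₀ x hx y hy y' hy' z hz z₀ hz₀ key
    exact ⟨h1.symm, h2, h3⟩

/-- NEAR-MISS made conditional: ANY finite group with a TPP triple beating the sum of the cubes
(`Σ_{Irr} d³ < |X||Y||Z|`) refutes `GradedCubePacking` (take `J = ⊤`, separate by point
indicators).  Such a group EXISTS IN PRINT — Cohn–Kleinberg–Szegedy–Umans 2005, §2 (read from the
held text, pp. 4–5): `G = (C_n³ × C_n³) ⋊ C₂`, `|G| = 2n⁶`,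
`S_i = {(a,b)zʲ : a ∈ H_i ∖ 0, b ∈ H_{i+1}}`, `|S_i| = 2n(n−1)`, TPP by their Lemma 2.1, all
character degrees `≤ 2` (index-2 abelian subgroup) so `Σ d³ ≤ 2|G| = 4n⁶ < 8n³(n−1)³` for
`n ≥ 5` (`n = 17` optimises, `ω < 2.9088`).  The smallest instance (`n = 5`, `|G| = 31250`, sets
of size `40`) is not formalised here: TPP over `40⁶` sextuples and the degree bound are out of
reach of `decide`, and the tree records only the implication `CKSU2005_thm18.omega_lt_three`,
not the example.  So `GradedCubePacking` is false, but its Lean refutation waits for the CKSU05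
§2 example (or any cube-beater) as a tree theorem.  Obstruction to a SMALL graded witness: with
a single isotypic block the walls `|X||Y|, |Y||Z|, |Z||X| ≤ dim J = d²` force volume `≤ d³`; two
blocks `d₁, d₂` need volume in `(d₁³ + d₂³, (d₁² + d₂²)^{3/2}]`; the first candidate,
`S₄` with `J = M_triv ⊕ M_3 ⊕ M_3'` (dim 19, budget 55), would need a separated — hence TPP —
triple of three 4-sets (volume 64), but the exhaustive searches recorded on the sibling item
`stmt-MatrixMultiplication-7612` (refuter g42-4 / route-review notes, 2026-08-15) give maximal
TPP volume `36` in `S₄` (and `8` in `S₃`), so no graded cube-beater lives in `S₃` or `S₄`. -/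
theorem not_gradedCubePacking_of_beatsCubes
    (h : ∃ (G : Type) (_ : Group G) (_ : Fintype G) (X Y Z : Finset G),
      (∀ s ∈ X, ∀ s' ∈ X, ∀ t ∈ Y, ∀ t' ∈ Y, ∀ u ∈ Z, ∀ u' ∈ Z,
        s * s'⁻¹ * (t * t'⁻¹) * (u * u'⁻¹) = 1 → s = s' ∧ t = t' ∧ u = u') ∧
      charDegreePowSum G 3 < ((X.card * Y.card * Z.card : ℕ) : ℝ)) :
    ¬ GradedCubePacking := by
  intro hcube
  obtain ⟨G, _, _, X, Y, Z, htpp, hlt⟩ := h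
  classical
  have hle := hcube G ⊤ biInvariant_top X Y Z (separated_top_of_tpp htpp)
  rw [Submodule.top_coe, Set.inter_univ] at hle
  change _ ≤ charDegreePowSum G 3 at hle
  linarith

end Tightness

/-! ## §2b One-sided invariance does not suffice (sharpest form of §1-A) -/

section LeftInvariance

open Equiv

/-- The symmetric group `S₃` as permutations of `Fin 3`. -/
abbrev S₃ : Type := Equiv.Perm (Fin 3)

def s01 : S₃ := swap 0 1
def s12 : S₃ := swap 1 2
def s02 : S₃ := swap 0 2
/-- the 3-cycle `0 ↦ 1 ↦ 2 ↦ 0` -/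
def c3 : S₃ := swap 0 1 * swap 1 2

/-- Entries of the 2-dimensional (standard) representation of `S₃` on the sum-zero lattice
`ℤ{e₀−e₁, e₁−e₂}` (`σ·e_j = e_{σ j}`), tabulated. -/
def r11 (σ : S₃) : ℤ :=
  if σ = 1 then 1 else if σ = s01 then -1 else if σ = s12 then 1 else if σ = s02 then 0
  else if σ = c3 then 0 else -1
def r12 (σ : S₃) : ℤ :=
  if σ = 1 then 0 else if σ = s01 then 1 else if σ = s12 then 0 else if σ = s02 then -1
  else if σ = c3 then -1 else 1
def r21 (σ : S₃) : ℤ :=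
  if σ = 1 then 0 else if σ = s01 then 0 else if σ = s12 then 1 else if σ = s02 then -1
  else if σ = c3 then 1 else -1
def r22 (σ : S₃) : ℤ :=
  if σ = 1 then 1 else if σ = s01 then 1 else if σ = s12 then -1 else if σ = s02 then 0
  else if σ = c3 then -1 else 0

/-- The first column transforms by the representation: `ρ(a g)_{i1} = Σ_k ρ(a)_{ik} ρ(g)_{k1}`
(checked over all 36 pairs). -/
theorem col_mul : ∀ a g : S₃,
    r11 (a * g) = r11 a * r11 g + r12 a * r21 g ∧ r21 (a * g) = r21 a * r11 g + r22 a * r21 g := by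
  decide

/-- The two conjugations used below: `c3² = s01·c3·s01⁻¹`, `s12 = c3·s01·c3⁻¹`. -/
theorem conj_facts : c3 * c3 = s01 * c3 * s01⁻¹ ∧ s12 = c3 * s01 * c3⁻¹ := by decide

theorem table_facts : r11 1 = 1 ∧ r21 1 = 0 ∧ r11 c3 = 0 ∧ r21 c3 = 1 ∧ r11 (c3 * c3) = -1 ∧
    r21 (c3 * c3) = -1 ∧ r11 s01 = -1 ∧ r21 s01 = 0 ∧ r11 s12 = 1 ∧ r21 s12 = 1 := by decide

/-- First-column matrix coefficients of the 2-dimensional irrep, as complex functions. -/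
def f₁ : S₃ → ℂ := fun σ => (r11 σ : ℂ)
def f₂ : S₃ → ℂ := fun σ => (r21 σ : ℂ)

/-- The column space `J_col = ℂ f₁ ⊕ ℂ f₂`. -/
def Jcol : Submodule ℂ (S₃ → ℂ) := Submodule.span ℂ {f₁, f₂}

/-- `J_col` is LEFT-invariant (`f ↦ f(a·)`). -/
theorem leftInvariant_Jcol : ∀ f ∈ Jcol, ∀ a : S₃, (fun g => f (a * g)) ∈ Jcol := by
  intro f hf a
  obtain ⟨α, β, rfl⟩ := Submodule.mem_span_pair.mp hf
  refine Submodule.mem_span_pair.mpr ⟨α * r11 a + β * r21 a, α * r12 a + β * r22 a, ?_⟩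
  funext g
  have h := col_mul a g
  simp only [Pi.add_apply, Pi.smul_apply, smul_eq_mul, f₁, f₂]
  rw [h.1, h.2]
  push_cast
  ring

/-- No irreducible character of `S₃` lies in `J_col`: a class function `α f₁ + β f₂` must vanish
(compare the values on the two conjugate pairs `(c3, c3²)` and `(s01, s12)`), but `χ(1) ≠ 0`. -/
theorem irrChars_inter_Jcol : irrChars S₃ ∩ (Jcol : Set (S₃ → ℂ)) = ∅ := by
  ext χ
  simp only [Set.mem_inter_iff, SetLike.mem_coe, Set.mem_empty_iff_false, iff_false, not_and]
  intro hχ hJ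
  obtain ⟨α, β, rfl⟩ := Submodule.mem_span_pair.mp hJ
  have hirr := hχ
  obtain ⟨V, _, _, _, ρ, hρ, hchar⟩ := hχ
  -- class-function identities
  have hc1 : ρ.character (s01 * c3 * s01⁻¹) = ρ.character c3 := Representation.char_conj ρ c3 s01
  have hc2 : ρ.character (c3 * s01 * c3⁻¹) = ρ.character s01 := Representation.char_conj ρ s01 c3
  rw [← conj_facts.1] at hc1
  rw [← conj_facts.2] at hc2
  rw [hchar] at hc1 hc2
  obtain ⟨t1, t2, t3, t4, t5, t6, t7, t8, t9, t10⟩ := table_facts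
  simp only [Pi.add_apply, Pi.smul_apply, smul_eq_mul, f₁, f₂, t3, t4, t5, t6, t7, t8, t9, t10]
    at hc1 hc2
  push_cast at hc1 hc2
  have hα : α = 0 := by linear_combination ((1:ℂ)/3) * hc1 + ((2:ℂ)/3) * hc2
  have hβ : β = 0 := by linear_combination (-(2:ℂ)/3) * hc1 + (-(1:ℂ)/3) * hc2
  apply apply_one_ne_zero hirr
  simp [hα, hβ]

/-- Mutation A': bi-invariance weakened to LEFT-invariance. -/
def GradedPricingLeftInvOnly : Prop :=
  ∀ (G : Type) [Group G] [Fintype G] (J : Submodule ℂ (G → ℂ)),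
    (∀ f ∈ J, ∀ a : G, (fun g : G => f (a * g)) ∈ J) →
    ∀ X Y Z : Finset G, Separated J X Y Z → volPow X Y Z ≤ budget G J

/-- **One-sided invariance does not suffice** (the two-sidedness of `J^⊥ ⊴ ℂ[G]` is essential):
`G = S₃`, `J = J_col` (left-invariant, one column of the 2-dim irrep), `X = Y = Z = {1}` is
separated by `f₁` (`f₁(1) = 1`), volume term `1`, but `Irr(S₃) ∩ J_col = ∅`, budget `0`. -/
theorem gradedPricing_false_with_leftInv_only : ¬ GradedPricingLeftInvOnly := by
  intro h
  have hsep : Separated Jcol {1} {1} {1} := by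
    intro x₀ hx₀ z₀ hz₀
    refine ⟨f₁, Submodule.subset_span (Set.mem_insert _ _), ?_⟩
    intro x hx y hy y' hy' z hz
    simp only [Finset.mem_singleton] at hx hy hy' hz hx₀ hz₀
    subst hx hy hy' hz hx₀ hz₀
    refine ⟨fun _ => ?_, fun hne => absurd ⟨rfl, rfl, rfl⟩ hne⟩
    simp [f₁, table_facts.1]
  have hle := h S₃ Jcol leftInvariant_Jcol {1} {1} {1} hsep
  rw [budget, irrChars_inter_Jcol, finsum_mem_empty] at hle
  have h1 : volPow ({1} : Finset S₃) {1} {1} = 1 := by simp [volPow]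
  linarith

end LeftInvariance

/-! ## §2c Right-invariance alone does not suffice either (cycle 2; mirror of §2b) -/

section RightInvariance

/-- Rows transform on the right: `ρ(g a)_{1j} = Σ_k ρ(g)_{1k} ρ(a)_{kj}` (all 36 pairs). -/
theorem row_mul : ∀ g a : S₃,
    r11 (g * a) = r11 g * r11 a + r12 g * r21 a ∧ r12 (g * a) = r11 g * r12 a + r12 g * r22 a := by
  decide

theorem table_facts_row : r12 1 = 0 ∧ r12 c3 = -1 ∧ r12 (c3 * c3) = 1 ∧ r12 s01 = 1 ∧
    r12 s12 = 0 := by decide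

/-- Second entry of the first ROW of the 2-dimensional irrep, as a complex function. -/
def f₁₂ : S₃ → ℂ := fun σ => (r12 σ : ℂ)

/-- The row space `J_row = ℂ f₁ ⊕ ℂ f₁₂` (`f₁ = ρ₁₁`, `f₁₂ = ρ₁₂`). -/
def Jrow : Submodule ℂ (S₃ → ℂ) := Submodule.span ℂ {f₁, f₁₂}

/-- `J_row` is RIGHT-invariant (`f ↦ f(·a)`). -/
theorem rightInvariant_Jrow : ∀ f ∈ Jrow, ∀ a : S₃, (fun g => f (g * a)) ∈ Jrow := by
  intro f hf a
  obtain ⟨α, β, rfl⟩ := Submodule.mem_span_pair.mp hf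
  refine Submodule.mem_span_pair.mpr ⟨α * r11 a + β * r12 a, α * r21 a + β * r22 a, ?_⟩
  funext g
  have h := row_mul g a
  simp only [Pi.add_apply, Pi.smul_apply, smul_eq_mul, f₁, f₁₂]
  rw [h.1, h.2]
  push_cast
  ring

/-- No irreducible character of `S₃` lies in `J_row` (class-function test on `(c3, c3²)` and
`(s01, s12)` forces `α = β = 0`, but `χ(1) ≠ 0`). -/
theorem irrChars_inter_Jrow : irrChars S₃ ∩ (Jrow : Set (S₃ → ℂ)) = ∅ := by
  ext χ
  simp only [Set.mem_inter_iff, SetLike.mem_coe, Set.mem_empty_iff_false, iff_false, not_and]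
  intro hχ hJ
  obtain ⟨α, β, rfl⟩ := Submodule.mem_span_pair.mp hJ
  have hirr := hχ
  obtain ⟨V, _, _, _, ρ, hρ, hchar⟩ := hχ
  have hc1 : ρ.character (s01 * c3 * s01⁻¹) = ρ.character c3 := Representation.char_conj ρ c3 s01
  have hc2 : ρ.character (c3 * s01 * c3⁻¹) = ρ.character s01 := Representation.char_conj ρ s01 c3
  rw [← conj_facts.1] at hc1
  rw [← conj_facts.2] at hc2
  rw [hchar] at hc1 hc2
  obtain ⟨t1, -, t3, -, t5, -, t7, -, t9, -⟩ := table_facts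
  obtain ⟨u1, u2, u3, u4, u5⟩ := table_facts_row
  simp only [Pi.add_apply, Pi.smul_apply, smul_eq_mul, f₁, f₁₂, t3, t5, t7, t9, u2, u3, u4, u5]
    at hc1 hc2
  push_cast at hc1 hc2
  have hα : α = 0 := by linear_combination ((1:ℂ)/3) * hc1 + ((2:ℂ)/3) * hc2
  have hβ : β = 0 := by linear_combination ((2:ℂ)/3) * hc1 + ((1:ℂ)/3) * hc2
  apply apply_one_ne_zero hirr
  simp [hα, hβ]

/-- Mutation A'': bi-invariance weakened to RIGHT-invariance. -/
def GradedPricingRightInvOnly : Prop :=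
  ∀ (G : Type) [Group G] [Fintype G] (J : Submodule ℂ (G → ℂ)),
    (∀ f ∈ J, ∀ a : G, (fun g : G => f (g * a)) ∈ J) →
    ∀ X Y Z : Finset G, Separated J X Y Z → volPow X Y Z ≤ budget G J

/-- **Right-invariance alone does not suffice** (mirror of §2b): `G = S₃`, `J = J_row`,
`X = Y = Z = {1}` separated by `f₁` (`f₁(1) = 1`), volume term `1`, budget `0`.  Together with
§2b: NEITHER one-sided ideal structure is enough; the proved crux uses both sides (two-sided
`J^⊥`, equivalently the matrix-unit sandwich `E_ac P E_cb`). -/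
theorem gradedPricing_false_with_rightInv_only : ¬ GradedPricingRightInvOnly := by
  intro h
  have hsep : Separated Jrow {1} {1} {1} := by
    intro x₀ hx₀ z₀ hz₀
    refine ⟨f₁, Submodule.subset_span (Set.mem_insert _ _), ?_⟩
    intro x hx y hy y' hy' z hz
    simp only [Finset.mem_singleton] at hx hy hy' hz hx₀ hz₀
    subst hx hy hy' hz hx₀ hz₀
    refine ⟨fun _ => ?_, fun hne => absurd ⟨rfl, rfl, rfl⟩ hne⟩
    simp [f₁, table_facts.1]
  have hle := h S₃ Jrow rightInvariant_Jrow {1} {1} {1} hsep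
  rw [budget, irrChars_inter_Jrow, finsum_mem_empty] at hle
  have h1 : volPow ({1} : Finset S₃) {1} {1} = 1 := by simp [volPow]
  linarith

end RightInvariance

/-! ## §4 Abelian hosts are dead even under graded pricing (cycle 2)

Landing copy: `Theorems/GradedPricing/Negative/AbelianHosts.lean` (same statements, namespace
`…Theorems.GradedPricing.Negative`). -/

section AbelianHosts

open Module

variable {A : Type} [CommGroup A] [Fintype A]

/-- **Graded abelian packing.**  In a finite abelian group, if `X, Y, Z` are separated by the
functions of a RIGHT-translation-invariant subspace `J` then `|X|·|Y|·|Z| ≤ dim J`: the translate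
`t ↦ f_{x₀z₀}(t y₀⁻¹)` lies in `J` and, by commutativity, restricts on the points `x⁻¹ y z` to the
indicator of `(x₀, y₀, z₀)`, so evaluation `J → ℂ^{X × Y × Z}` is onto (block-triangular count
`card_add_card_le_finrank` of the sibling crux's `GradedNeumannCount`, with an empty second block). -/
theorem volume_le_finrank_of_comm (J : Submodule ℂ (A → ℂ))
    (hJ : ∀ f ∈ J, ∀ a : A, (fun g => f (g * a)) ∈ J) (X Y Z : Finset A)
    (hsep : Separated J X Y Z) : X.card * Y.card * Z.card ≤ finrank ℂ J := by
  classical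
  have h := Theorems.LevelTwoBeatsCubes.Negative.card_add_card_le_finrank
    (A := ↥(X ×ˢ Y ×ˢ Z)) (S := Fin 0) J
    (fun a => a.1.1⁻¹ * a.1.2.1 * a.1.2.2) Fin.elim0 ?_ (fun s => Fin.elim0 s)
  · simp only [Fintype.card_coe, Fintype.card_fin, add_zero] at h
    rw [Finset.card_product, Finset.card_product, ← mul_assoc] at h
    exact h
  · rintro ⟨⟨x₀, y₀, z₀⟩, h₀⟩
    simp only [Finset.mem_product] at h₀
    obtain ⟨f, hf, hspec⟩ := hsep x₀ h₀.1 z₀ h₀.2.2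
    refine ⟨fun t => f (t * y₀⁻¹), hJ f hf _, ?_, ?_, fun s => Fin.elim0 s⟩
    · show f (x₀⁻¹ * y₀ * z₀ * y₀⁻¹) = 1
      rw [mul_right_comm (x₀⁻¹ * y₀) z₀ y₀⁻¹]
      exact (hspec x₀ h₀.1 y₀ h₀.2.1 y₀ h₀.2.1 z₀ h₀.2.2).1 ⟨rfl, rfl, rfl⟩
    · rintro ⟨⟨x, y, z⟩, hxyz⟩ hne
      simp only [Finset.mem_product] at hxyz
      show f (x⁻¹ * y * z * y₀⁻¹) = 0
      rw [mul_right_comm (x⁻¹ * y) z y₀⁻¹]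
      refine (hspec x hxyz.1 y hxyz.2.1 y₀ h₀.2.1 z hxyz.2.2).2 ?_
      rintro ⟨rfl, rfl, rfl⟩
      exact hne rfl

/-- Fourier support: a right-translation-invariant `J` (finite abelian group) contains every
irreducible character pairing non-trivially with one of its members, because
`Σ_t χ(t⁻¹) f(g t) = (Σ_s f(s) χ(s⁻¹)) · χ(g)` is a combination of translates of `f`. -/
theorem irrChar_mem_of_classInner_ne_zero (J : Submodule ℂ (A → ℂ))
    (hJ : ∀ f ∈ J, ∀ a : A, (fun g => f (g * a)) ∈ J) {f χ : A → ℂ} (hf : f ∈ J)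
    (hχ : IsIrrChar A χ) (hne : classInner f χ ≠ 0) : χ ∈ J := by
  haveI : IsMulCommutative A := ⟨⟨mul_comm⟩⟩
  set c : ℂ := ∑ s : A, f s * χ s⁻¹ with hc
  have hc0 : c ≠ 0 := by
    intro h0
    apply hne
    rw [classInner_apply, ← hc, h0, mul_zero]
  have hF : (fun g => ∑ t : A, χ t⁻¹ * f (g * t)) ∈ J := by
    have e : (fun g => ∑ t : A, χ t⁻¹ * f (g * t)) = ∑ t : A, χ t⁻¹ • (fun g => f (g * t)) := by
      funext g
      simp only [Finset.sum_apply, Pi.smul_apply, smul_eq_mul]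
    rw [e]
    exact Submodule.sum_mem _ fun t _ => Submodule.smul_mem _ _ (hJ f hf t)
  have hkey : (fun g => ∑ t : A, χ t⁻¹ * f (g * t)) = c • χ := by
    funext g
    rw [Pi.smul_apply, smul_eq_mul]
    calc ∑ t : A, χ t⁻¹ * f (g * t)
        = ∑ s : A, χ (g⁻¹ * s)⁻¹ * f (g * (g⁻¹ * s)) :=
          Fintype.sum_equiv (Equiv.mulLeft g) _ _ (fun t => by
            simp only [Equiv.coe_mulLeft, inv_mul_cancel_left])
      _ = ∑ s : A, f s * χ s⁻¹ * χ g := by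
          refine Finset.sum_congr rfl fun s _ => ?_
          rw [mul_inv_rev, inv_inv, mul_inv_cancel_left, hχ.map_mul]
          ring
      _ = c * χ g := by rw [hc, Finset.sum_mul]
  have hχeq : χ = c⁻¹ • (fun g => ∑ t : A, χ t⁻¹ * f (g * t)) := by
    rw [hkey, smul_smul, inv_mul_cancel₀ hc0, one_smul]
  rw [hχeq]
  exact Submodule.smul_mem _ _ hF

/-- Hence `J ≤ span (Irr(A) ∩ J)` (Fourier expansion of a class function; on an abelian group every
function is a class function). -/
theorem le_span_irrChars_inter_of_comm (J : Submodule ℂ (A → ℂ))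
    (hJ : ∀ f ∈ J, ∀ a : A, (fun g => f (g * a)) ∈ J) :
    J ≤ Submodule.span ℂ (irrChars A ∩ (J : Set (A → ℂ))) := by
  intro f hf
  have hcl : IsClassFun f := fun s t => by rw [mul_comm t s, mul_inv_cancel_right]
  rw [hcl.eq_sum_classInner_smul]
  refine Submodule.sum_mem _ fun χ hχ => ?_
  have hχ' : IsIrrChar A χ := (irrChars_finite_holds A).mem_toFinset.mp hχ
  by_cases h0 : classInner f χ = 0
  · rw [h0, zero_smul]
    exact Submodule.zero_mem _
  · exact Submodule.smul_mem _ _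
      (Submodule.subset_span ⟨hχ', irrChar_mem_of_classInner_ne_zero J hJ hf hχ' h0⟩)

/-- `dim J ≤ #(Irr(A) ∩ J)` for right-translation-invariant `J`. -/
theorem finrank_le_card_irrChars_inter_of_comm (J : Submodule ℂ (A → ℂ))
    (hJ : ∀ f ∈ J, ∀ a : A, (fun g => f (g * a)) ∈ J) :
    finrank ℂ J ≤ (irrChars_inter_finite J).toFinset.card := by
  have hspan : Submodule.span ℂ (irrChars A ∩ (J : Set (A → ℂ)))
      = Submodule.span ℂ ((irrChars_inter_finite J).toFinset : Set (A → ℂ)) := by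
    rw [Set.Finite.coe_toFinset]
  calc finrank ℂ J ≤ finrank ℂ (Submodule.span ℂ (irrChars A ∩ (J : Set (A → ℂ)))) :=
        Submodule.finrank_mono (le_span_irrChars_inter_of_comm J hJ)
    _ = finrank ℂ (Submodule.span ℂ ((irrChars_inter_finite J).toFinset : Set (A → ℂ))) := by
        rw [hspan]
    _ ≤ (irrChars_inter_finite J).toFinset.card := finrank_span_finset_le_card _

/-- In an abelian group the graded budget at ANY exponent is `#(Irr ∩ J)` (all degrees are `1`). -/
theorem budget_eq_card_of_comm (J : Submodule ℂ (A → ℂ)) (s : ℝ) :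
    ∑ᶠ χ ∈ irrChars A ∩ (J : Set (A → ℂ)), (χ 1).re ^ s
      = ((irrChars_inter_finite J).toFinset.card : ℝ) := by
  haveI : IsMulCommutative A := ⟨⟨mul_comm⟩⟩
  rw [finsum_mem_eq_finite_toFinset_sum _ (irrChars_inter_finite J)]
  have : ∀ χ ∈ (irrChars_inter_finite J).toFinset, (χ 1).re ^ s = 1 := by
    intro χ hχ
    have hχ' : IsIrrChar A χ := ((irrChars_inter_finite J).mem_toFinset.mp hχ).1
    rw [hχ'.map_one, Complex.one_re, Real.one_rpow]
  rw [Finset.sum_congr rfl this, Finset.sum_const, nsmul_eq_mul, mul_one]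

/-- **The crux holds in abelian groups with `ω` replaced by ANY exponent `0 < s ≤ 3`**:
`(|X||Y||Z|)^{s/3} ≤ Σᶠ_{χ∈Irr∩J} χ(1)^s` — no room whatsoever below exponent `3`. -/
theorem rpow_volume_le_gradedBudget_of_comm (J : Submodule ℂ (A → ℂ)) (hJ : BiInvariant J)
    (X Y Z : Finset A) (hsep : Separated J X Y Z) {s : ℝ} (hs0 : 0 < s) (hs3 : s ≤ 3) :
    ((X.card * Y.card * Z.card : ℕ) : ℝ) ^ (s / 3)
      ≤ ∑ᶠ χ ∈ irrChars A ∩ (J : Set (A → ℂ)), (χ 1).re ^ s := by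
  have hr : ∀ f ∈ J, ∀ a : A, (fun g => f (g * a)) ∈ J := fun f hf a => by
    simpa only [one_mul] using hJ f hf 1 a
  have hV : ((X.card * Y.card * Z.card : ℕ) : ℝ) ≤ ∑ᶠ χ ∈ irrChars A ∩ (J : Set (A → ℂ)), (χ 1).re ^ s := by
    rw [budget_eq_card_of_comm]
    exact_mod_cast (volume_le_finrank_of_comm J hr X Y Z hsep).trans
      (finrank_le_card_irrChars_inter_of_comm J hr)
  rcases Nat.eq_zero_or_pos (X.card * Y.card * Z.card) with h0 | hpos
  · rw [h0, Nat.cast_zero, Real.zero_rpow (div_pos hs0 three_pos).ne']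
    rw [h0, Nat.cast_zero] at hV
    exact hV
  · have h1 : (1 : ℝ) ≤ ((X.card * Y.card * Z.card : ℕ) : ℝ) := by exact_mod_cast hpos
    calc ((X.card * Y.card * Z.card : ℕ) : ℝ) ^ (s / 3)
        ≤ ((X.card * Y.card * Z.card : ℕ) : ℝ) ^ (1 : ℝ) :=
          Real.rpow_le_rpow_of_exponent_le h1 (by linarith)
      _ = ((X.card * Y.card * Z.card : ℕ) : ℝ) := Real.rpow_one _
      _ ≤ _ := hV

/-- The route's target `GradedDesignFamily` RESTRICTED TO ABELIAN HOSTS (same body, `CommGroup`). -/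
def AbelianGradedDesignFamily : Prop :=
  ∀ ε : ℝ, 0 < ε → ∃ (G : Type) (_ : CommGroup G) (_ : Fintype G) (J : Submodule ℂ (G → ℂ))
    (X Y Z : Finset G), BiInvariant J ∧ Separated J X Y Z ∧
    (∑ᶠ χ ∈ irrChars G ∩ (J : Set (G → ℂ)), (χ 1).re ^ (2 + ε))
      < ((X.card * Y.card * Z.card : ℕ) : ℝ) ^ ((2 + ε) / 3)

/-- **Abelian hosts are dead even under graded pricing**: the abelian version of the route target
is FALSE (take `ε = 1`; more generally no abelian witness exists at any `0 < ε ≤ 1`). -/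
theorem not_abelianGradedDesignFamily : ¬ AbelianGradedDesignFamily := by
  intro h
  obtain ⟨G, _, _, J, X, Y, Z, hJ, hsep, hlt⟩ := h 1 one_pos
  exact absurd hlt (not_lt.mpr
    (rpow_volume_le_gradedBudget_of_comm J hJ X Y Z hsep (by norm_num) (by norm_num)))

end AbelianHosts

/-! ## §5 Walls and the exponent-2 endpoint (general `G`, cycle 2) -/

section Walls

open Module

variable {G : Type} [Group G] [Fintype G]

/-- **Walls.**  For a bi-invariant `J` and a `J`-separated triple, `|X||Y|, |Y||Z|, |X||Z| ≤ dim J`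
(graded Neumann count of the sibling crux, `packing_X` / `packing_Z`), hence `V² ≤ (dim J)³`.
In particular a single isotypic block (`dim J = d²`) carries volume `≤ d³`: it never beats its own
cube, so graded cube-beaters need at least two blocks. -/
theorem volume_sq_le_finrank_cube (J : Submodule ℂ (G → ℂ)) (hJ : BiInvariant J)
    (X Y Z : Finset G) (h : Separated J X Y Z) :
    (X.card * Y.card * Z.card) ^ 2 ≤ (finrank ℂ J) ^ 3 := by
  classical
  rcases X.eq_empty_or_nonempty with rfl | ⟨x₁, hx₁⟩
  · simp
  rcases Y.eq_empty_or_nonempty with rfl | ⟨y₁, hy₁⟩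
  · simp
  rcases Z.eq_empty_or_nonempty with rfl | ⟨z₁, hz₁⟩
  · simp
  have hr : ∀ f ∈ J, ∀ t : G, (fun g => f (g * t)) ∈ J := fun f hf t => by
    simpa only [one_mul] using hJ f hf 1 t
  have hl : ∀ f ∈ J, ∀ t : G, (fun g => f (t * g)) ∈ J := fun f hf t => by
    simpa only [mul_one] using hJ f hf t 1
  have N1 := Theorems.LevelTwoBeatsCubes.Negative.packing_X J hr X Y Z h hy₁ hz₁
  have N2 := Theorems.LevelTwoBeatsCubes.Negative.packing_Z J hl X Y Z h hx₁ hy₁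
  have ha : 1 ≤ X.card := Finset.card_pos.mpr ⟨x₁, hx₁⟩
  have hb : 1 ≤ Y.card := Finset.card_pos.mpr ⟨y₁, hy₁⟩
  have hc : 1 ≤ Z.card := Finset.card_pos.mpr ⟨z₁, hz₁⟩
  obtain ⟨b, hbY⟩ : ∃ b, Y.card = b + 1 := ⟨Y.card - 1, by omega⟩
  rw [hbY] at N1 N2 ⊢
  simp only [Nat.add_sub_cancel] at N1 N2
  set a := X.card
  set c := Z.card
  set D := finrank ℂ J
  have hab : a * (b + 1) ≤ D :=
    calc a * (b + 1) = a * b + a * 1 := by ring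
      _ ≤ a * b + a * c := Nat.add_le_add_left (Nat.mul_le_mul_left a hc) _
      _ = a * c + a * b := Nat.add_comm _ _
      _ ≤ D := N1
  have hac : a * c ≤ D := le_trans (Nat.le_add_right _ _) N1
  have hbc : (b + 1) * c ≤ D :=
    calc (b + 1) * c = 1 * c + b * c := by ring
      _ ≤ a * c + b * c := Nat.add_le_add_right (Nat.mul_le_mul_right c ha) _
      _ ≤ D := N2
  calc (a * (b + 1) * c) ^ 2 = (a * (b + 1)) * ((b + 1) * c) * (a * c) := by ring
    _ ≤ D * D * D := Nat.mul_le_mul (Nat.mul_le_mul hab hbc) hac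
    _ = D ^ 3 := by ring

/-- **Exponent-2 endpoint.**  `(|X||Y||Z|)^{2/3} ≤ dim J` for every bi-invariant `J` and every
`J`-separated triple — the crux's inequality with `ω` replaced by `2` and the budget
`Σ_{χ∈J} χ(1)² = dim J` (Peter–Weyl) is a triviality of the walls; the proved crux (`ω`) and the
false exponent-`3` form (§2) bracket it. -/
theorem rpow_two_thirds_volume_le_finrank (J : Submodule ℂ (G → ℂ)) (hJ : BiInvariant J)
    (X Y Z : Finset G) (h : Separated J X Y Z) :
    ((X.card * Y.card * Z.card : ℕ) : ℝ) ^ ((2 : ℝ) / 3) ≤ (finrank ℂ J : ℝ) := by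
  have hsq := volume_sq_le_finrank_cube J hJ X Y Z h
  have hsqR : (((X.card * Y.card * Z.card : ℕ) : ℝ)) ^ (2 : ℝ) ≤ ((finrank ℂ J : ℕ) : ℝ) ^ (3 : ℝ) := by
    rw [show (2 : ℝ) = ((2 : ℕ) : ℝ) by norm_num, show (3 : ℝ) = ((3 : ℕ) : ℝ) by norm_num,
      Real.rpow_natCast, Real.rpow_natCast]
    exact_mod_cast hsq
  have hV0 : (0 : ℝ) ≤ ((X.card * Y.card * Z.card : ℕ) : ℝ) := Nat.cast_nonneg _
  have hD0 : (0 : ℝ) ≤ ((finrank ℂ J : ℕ) : ℝ) := Nat.cast_nonneg _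
  calc ((X.card * Y.card * Z.card : ℕ) : ℝ) ^ ((2 : ℝ) / 3)
      = ((((X.card * Y.card * Z.card : ℕ) : ℝ)) ^ (2 : ℝ)) ^ ((1 : ℝ) / 3) := by
        rw [← Real.rpow_mul hV0]; norm_num
    _ ≤ (((finrank ℂ J : ℕ) : ℝ) ^ (3 : ℝ)) ^ ((1 : ℝ) / 3) :=
        Real.rpow_le_rpow (Real.rpow_nonneg hV0 _) hsqR (by norm_num)
    _ = ((finrank ℂ J : ℕ) : ℝ) := by
        rw [← Real.rpow_mul hD0]; norm_num

end Walls

/-! ## Targets (lead's stuck stubs)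

None: `payload.stuck_stubs = []` at cycles 1 and 2, and the crux itself has a kernel-checked proof
(`SketchIdeator1.lean`, re-verified in cycle 2), awaiting a prover's landing. -/

/-! ## §3 Why it resists -/

/-- WHY THE CRUX RESISTS (briefing for provers; nothing to prove here, `True`).

1. MATHEMATICS.  `ℂ^G` as a `G×G`-module (`(a,b)·f = f(a⁻¹ · b)`) is multiplicity-free:
   `ℂ^G = ⊕_ρ M_ρ`, `M_ρ = span{g ↦ ρ(g)_{ij}}` pairwise non-isomorphic simple bimodules
   (Peter–Weyl / Wedderburn).  Hence a bi-invariant `J` is `⊕_{ρ ∈ S} M_ρ`, and `χ_ρ ∈ J ↔ ρ ∈ S`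
   (`χ_ρ ∈ M_ρ`).  For `f ∈ M_ρ`, `f(Â·B̂) = tr(ρ(Â)ρ(B̂)C_f)` depends only on `ρ(Â), ρ(B̂)`;
   with `Â = Σ A_{xy} x⁻¹y`, `B̂ = Σ B_{y'z} y'⁻¹z` and the separating `f_{x₀z₀} ∈ J`,
   `(AB)_{x₀z₀} = f_{x₀z₀}(ÂB̂)`, i.e. `⟨|X|,|Y|,|Z|⟩ ≤ ⊕_{ρ∈S} ⟨d_ρ,d_ρ,d_ρ⟩` (a RESTRICTION, no
   injectivity needed — TPP is a consequence, `realizesTPP_of_separated`).  Then verbatim the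
   tensor-power argument of `rpow_omega_le_sum_blockDegrees_rpow` (CohnUmansTPPProofs):
   `(nmp)^{Nω/3} ≤ R(⟨n^N,m^N,p^N⟩) ≤ C_ε (Σ_{ρ∈S} d_ρ^{ω+ε})^N`, `N → ∞`, `ε → 0`.
2. TREE LEMMAS TO REUSE.  `exists_algEquiv_pi_matrix` / `BlockAlgebraC` / `blockRep`,
   `isIrreducible_blockRep`, `character_blockRep_injective` (WedderburnBlocks);
   `rpow_omega_div_three_le_tensorRank`, `exists_tensorRank_matMulTensor_le_rpow`,
   `le_of_pow_le_mul_pow`, `le_of_forall_pos_le_sum_rpow` (CohnUmansTPPProofs);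
   `tensorRank_matMulTensor_pow_le_of_algEquiv` (GroupAlgebraTensor) is the model for the missing
   `…_of_restrictsTo_blockSubfamily`; `irrChars_finite_holds`, `IsIrrChar.classInner_eq`,
   `linearIndependent_irrChars`, isotypic projectors (IsotypicProjector) for `J = ⊕_{ρ∈S} M_ρ`.
3. ONE BOOKKEEPING SUBTLETY (not a defect).  Use test functions as FUNCTIONALS: the linear
   extension `u ↦ Σ_g u_g f(g)` of `f ∈ M_ρ` (a matrix coefficient `g ↦ tr(ρ(g)C)`) is
   `u ↦ tr(ρ(u)C)`, so it factors through the Wedderburn block of `ρ` itself, and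
   `J^⊥ := {u : f(u) = 0 ∀ f ∈ J} = ⊕_{ρ ∉ S}` blocks, `ℂ[G]/J^⊥ ≅ ⊕_{ρ ∈ S} M_{d_ρ}(ℂ)` — no duality.
   If instead one EMBEDS `f ↦ Σ_g f(g)·g ∈ ℂ[G]`, then `M_ρ` lands in the block of the DUAL `ρ*`
   (Schur orthogonality pairs `ρ_{ij}` with `ρ*`; e.g. `Σ_g χ(g)·g` has `ψ`-component
   `|G|·[ψ = χ̄]` for abelian `G`).  Harmless for the inequality (`d_ρ = d_{ρ*}`), but a proof that
   names blocks should use the functional/annihilator picture to keep `χ_ρ ∈ J ↔ block ρ is read`.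
4. NO JUNK ESCAPES (§0): `ω/3 > 0`; finsum finite; degrees `≥ 1`; `J = ⊤` case = proved CKSU Thm 1.8
   (`gradedPricing_top`); universe `G : Type` matches `irrChars`.
5. LOAD-BEARING (§1): bi-invariance and both halves of the pattern are each necessary; the bound is
   attained (§2), so no slack to trade. -/
theorem whyItResists : True := trivial

end Summit.MatrixMultiplication.MatrixMultiplication.Cruxes.GradedPricing.Disproof

end
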